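import Summits.AtomisticToContinuum.BoseEinsteinCondensation.Theorems.BECGroundStateSOSPeriodicIRBoundFsumReduction

/-!
# Line `fsum-phase-pencil` — crux `BECGroundStateSOS.PeriodicIRBound` (stmt-AtomisticToContinuum-3972)
· skeleton v9-c10 (line lead seat c10, 2026-08-16T23:55Z) = v8-c9 BYTE-IDENTICAL below this paragraph (same four
registered stubs S1 `BackflowBound`, S4′ `CondensatePairingSign`, S5a `CondensateNumberVariance`, S6 `NonIntegrableHalf`;
same landed composition `periodicIRBound_of_pairingSign`, p130612). Seat c10's verdict on the LINE (details in
`Cruxes/PeriodicIRBound/Lines/fsum-phase-pencil-dead.md`): the four open stubs are jointly of thermodynamic-limit-BEC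
strength — kernel-checked: `stub_fsumReduction` (S1 ∧ S4′ ∧ S5a ⇒ `IRBoundFor v` for every admissible integrable `v`)
composed with the landed `LandauToPeriodicBEC.periodicBEC_of_irBoundFor` (p99222: `IRBoundFor v` ⇒ torus BEC
`n₀ ≥ N/2` of near-minimisers at every small density, eventually in `N`) — and none of them is in print or suppliable
by the line's `Leans on:`; no reshape inside the line lowers that floor (the floor is a property of the crux, which the
route itself files `[difficulty: open-problem]`). The line is therefore closed as a LEAD-able plan; its content survives
as the 28 landed modules `Theorems/BECGroundStateSOSPeriodicIRBoundFsum*.lean`, which fire without a line if the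
inputs are ever proved.
· skeleton v8-c9 (line lead seat c9, 2026-08-16T23:40Z) = v7-c8 with the statements UNCHANGED (same four registered
stubs, same landed composition) and one correction of the plan recorded here and in
`Cruxes/PeriodicIRBound/NegativeStaticBackflowCoherent.md`: the typed alternative `StaticBackflowCurrent`
(`‖R_kΨ‖² ≤ CN‖k̃‖⁴ + ε`, landed reduction `stub_backflowOfStatic` p128588) is INCONSISTENT with T = 0 superfluid
hydrodynamics and must not be pursued — the COHERENT (one-phonon) backflow of the depletion cloud gives
`‖R_kΨ₀‖² ≳ N·c·d²·‖k̃‖³` (`c = 4√(πρa)` the sound velocity, `d = 1 − N₀/N ≈ (8/3√π)√(ρa³)` the depletion; the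
one-phonon amplitude of `R_k = W_k − ‖k̃‖²U_k` is `ω_k⟨k|ρ_k†|0⟩ − ‖k̃‖²⟨k|U_k|0⟩ = √(Nc)·d·‖k̃‖^{3/2}`, which vanishes
in strict Bogoliubov theory only because `N₀ = N` there), i.e. `≈ 16 N ρ^{3/2}a^{7/2}‖k̃‖³ ≫ C N‖k̃‖⁴` at the bottom
of the window `‖k̃‖ = 2π/L_N → 0`; seat c8's `1.4 N√(ρa³)‖k̃‖⁴` is only the incoherent two-quasiparticle part. The
registered S1 `BackflowBound` is NOT affected: the same coherent term contributes `β_k ≈ N₀·c·d·‖k̃‖ = O(Nρa²‖k̃‖)`,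
far inside its allowance `C·N√ρ‖k̃‖`. State: S2, S3, S5 CLOSED and LANDED; S4 RESHAPED (seat c8) into the strictly
weaker S4′ `CondensatePairingSign`; the whole composition is the landed reduction module
`Theorems/BECGroundStateSOSPeriodicIRBoundFsumReduction.lean`, so this file is thin: 4 sorries = exactly the open named
statements S1 `BackflowBound`, S4′ `CondensatePairingSign`, S5a `CondensateNumberVariance`, S6 `NonIntegrableHalf` —
all four consistent with Bogoliubov/Gavoret–Nozières asymptotics (audit of seat c9, the negative note above) and all
four of research strength (S5a = no-cat in the thermodynamic box; S6 = the crux verbatim on hard cores).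

**The crux** (fixed; `Theses.BECGroundStateSOS.PeriodicIRBound`, unfolded by the landed `Negative.periodicIRBound_iff`
into `∀ v admissible, IRBoundFor v`): the T = 0 infrared bound `n_k(Ψ) ≤ C√ρ L_N/‖k‖_∞` for `δ`-near-minimisers
(`δ` AFTER `N`) of the periodic `N`-body energy on the torus `L_N = (N/ρ)^{1/3}`, every mode `0 < ‖k‖_∞ ≤ κ√ρ L_N`,
all `ρ < ρ₀(v, κ)`, eventually in `N`.

**The line (one paragraph).** Two generators per mode, in FIRST quantisation: the density wave `ρ_k†Ψ = (∑ⱼ e_k(xⱼ))Ψ`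
(multiplication operator, `[V, ρ_k†] = 0`, `(H−E₀)`-weight = f-sum rule `N‖k̃‖²`) and the number-conserving condensate
PHASE transfer `U_kΨ = (a_k†a₀ − a₀†a₋ₖ)Ψ`. The kinetic commutator splits EXACTLY, `W_k := [T, ρ_k†] = ‖k̃‖²U_k + R_k`,
so Cauchy–Schwarz in the cone `H − E₀ ≥ 0` for the pair `(ρ_k†Ψ, U_kΨ)` reads `(‖k̃‖²‖U_kΨ‖² + β_k)² ≤ F·𝒴` with
`F ≤ 2N‖k̃‖²` (f-sum, S2 LANDED), `𝒴 = Q(U_kΨ) ≤ CN(‖k̃‖²+ρ)` (double commutator, S3 LANDED), `β_k = Re⟨U_kΨ, R_kΨ⟩`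
(BACKFLOW, S1 open — the correlation bound; the static norm bound is heuristically false, see above); a quadratic inequality gives
`‖T_{k0}Ψ‖² + ‖T_{0,−k}Ψ‖² ≤ C N√ρL/‖k‖_∞` once the condensate pairing amplitude has the Bogoliubov SIGN up to `O(N)`
(S4′ open: `Re⟨T_{k0}Ψ, T_{0,−k}Ψ⟩ ≤ CN`); the normalisation `⟨n₀n_k⟩ ↦ n_k` is the fixed-`(N,L)` bootstrap (S5 LANDED:
Fourier-diagonal moment inequality + dichotomy + coupling continuity from the Ky Fan gap) with the no-cat input S5a
(open); hard cores are S6 (not reduced).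

**Landed by the line** (all `--supports stmt-AtomisticToContinuum-3972`; modules `Theorems/BECGroundStateSOSPeriodicIRBoundFsum*.lean`):
Defs p123689 (+§4 `CondensatePairingSign` p130368); S2: ConeCS p124530, ConeMultiplier p124666, ConeIBP p125444, ConePhaseUp p125476,
ConeBlock p125841; S3: DCAdjoint p125788, DCPotSlot p126319, DCKinetic p126471, DCTautology p126641, DCPotPair p126655 (seat c7),
DCPotAdj p128088, DCPotPairs p128339, DCPotNear p128829, DCPotReduce p128878, DCAssembly p129128, DoubleCommutator p129428 (seat c8);
S1 ⟸ Static: BackflowOfStatic p128588; S5: OccFourier p128758, ExcitedPairs p129779, MomentIneq p129856, PathTransport p129965,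
WindowSum p129985, BootstrapAssembly p130121, Dichotomy p130127, CouplingSelect p130187, NormalisationBootstrap p130429;
reduction: Reduction (this composition, `periodicIRBound_of_pairingSign`, S4 ⇒ S4′).

**Disproof.lean honoured** (§1–§22, unchanged since 2026-08-16T05:27Z; §22 Targets concern the sibling line only): §5 —
near-minimality is USED (positivity of `H − E₀` + `√δ` defects in S2/S3; "`∀ε ∃δ` after `N, k`" in S1/S4′/S5a); §8 — `δ`
after `N, k, ε` everywhere; §6/§7 finite range and `ρ < ρ₀` kept; §9 free gas — `0 ∈ 𝒱(R₀,V₁)` and every stub exact or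
trivial there (`R_kΨ₀ = 0`, `Re A_k = 0`, `Var n₀ = 0`); §11 — the "`∀ε ∃δ`" frame is the `γ_N(k)` reading; §12 `k ≠ 0`
via `InWindow`; §13 `C ∝ √a` carried by the `√ρ` terms; §19 — S6 is that half, flagged not reduced. No stub is an
instance of a landed `Negative/*` lemma.
-/

noncomputable section

open MeasureTheory Filter
open scoped ENNReal NNReal ComplexConjugate BigOperators

namespace Summit.AtomisticToContinuum.BoseEinsteinCondensation.Cruxes.PeriodicIRBound.FsumPhasePencil

open Literature.MathematicalPhysics.QuantumManyBody.BoseGas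
open Summit.AtomisticToContinuum.BoseEinsteinCondensation.Theses.BECGroundStateSOS (PeriodicIRBound)

/-! ## §4 Audit names of the open stub statements -/

namespace Goal

/-- Statement of S1 `stub_backflowBound`. -/
abbrev stub_backflowBound : Prop := BackflowBound
/-- Statement of S4′ `stub_condensatePairingSign` (reshape of S4 `CondensateDensityQuadrature`, seat c8). -/
abbrev stub_condensatePairingSign : Prop := CondensatePairingSign
/-- Statement of S5a `stub_condensateNumberVariance`. -/
abbrev stub_condensateNumberVariance : Prop := CondensateNumberVariance
/-- Statement of S6 `stub_nonIntegrableHalf`. -/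
abbrev stub_nonIntegrableHalf : Prop := NonIntegrableHalf

end Goal

/-! ## §5 Registered stubs (the only `sorry`s of this file) -/

/-- S1 (XL, hardest; the load) — see `BackflowBound`: the CORRELATION bound `|β_k| ≤ C(N√ρ‖k̃‖ + √N‖k̃‖²‖U_kΨ‖) + ε`.
Do not route it through `StaticBackflowCurrent` (`stub_backflowOfStatic`, p128588): that norm bound is heuristically
false at the bottom of the window (coherent depletion backflow `‖R_kΨ₀‖² ≍ N c d² ‖k̃‖³`, seat c9,
`Cruxes/PeriodicIRBound/NegativeStaticBackflowCoherent.md`), whereas `β_k ≈ N₀ c d ‖k̃‖ = O(Nρa²‖k̃‖)` fits the first term. -/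
theorem stub_backflowBound : BackflowBound := by
  sorry

-- S2 `stub_phaseConeBlock : PhaseConeBlock` — CLOSED, LANDED p125841 (…FsumConeBlock.lean).
-- S3 `stub_phaseDoubleCommutator : PhaseDoubleCommutator` — CLOSED, LANDED p129428 (…FsumDoubleCommutator.lean).

/-- S4′ (crux-strength but with super-extensive room; reshape of S4) — see `CondensatePairingSign`;
`CondensateDensityQuadrature → CondensatePairingSign` is `condensatePairingSign_of_densityQuadrature` (LANDED). -/
theorem stub_condensatePairingSign : CondensatePairingSign := by
  sorry

/-- S5a (XL, open no-cat) — see `CondensateNumberVariance`. -/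
theorem stub_condensateNumberVariance : CondensateNumberVariance := by
  sorry

-- S5 `stub_normalisationBootstrap : NormalisationBootstrap` — CLOSED, LANDED p130429 (…FsumNormalisationBootstrap.lean).

/-- S6 (XL, not reduced) — see `NonIntegrableHalf`. -/
theorem stub_nonIntegrableHalf : NonIntegrableHalf := by
  sorry

/-! ## §6 Composition (sorry-free, entirely in the landed reduction module): the crux BY NAME -/

/-- **`PeriodicIRBound` from the four open registered stubs** (glue shape: hypotheses = the open stubs by name,
conclusion = the route decl by name; S2, S3, S5 are supplied inside the LANDED `periodicIRBound_of_pairingSign`).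
[folklore] -/
theorem PeriodicIRBound_of (h1 : Goal.stub_backflowBound) (h4 : Goal.stub_condensatePairingSign)
    (h5a : Goal.stub_condensateNumberVariance) (h6 : Goal.stub_nonIntegrableHalf) : PeriodicIRBound :=
  periodicIRBound_of_pairingSign h1 h4 h5a h6

/-- The skeleton applied to the (sorried) stubs: `PeriodicIRBound` modulo exactly S1, S4′, S5a, S6. -/
theorem PeriodicIRBound_proof : PeriodicIRBound :=
  PeriodicIRBound_of stub_backflowBound stub_condensatePairingSign stub_condensateNumberVariance
    stub_nonIntegrableHalf

end Summit.AtomisticToContinuum.BoseEinsteinCondensation.Cruxes.PeriodicIRBound.FsumPhasePencil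

end
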